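import Mathlib
import Summits.Ventures.PercRepro2.Defs
import Summits.Ventures.PercRepro2.Independence
import Summits.Ventures.PercRepro2.Harris
import Summits.Ventures.PercRepro2.Graph
import Summits.Ventures.PercRepro2.Exploration
import Summits.Ventures.PercRepro2.Events
import Summits.Ventures.PercRepro2.FourFunctions
import Summits.Ventures.PercRepro2.Induced
import Summits.Ventures.PercRepro2.Frontier
import Summits.Ventures.PercRepro2.ObsIndependence
import Summits.Ventures.PercRepro2.BHK
import Summits.Ventures.PercRepro2.BHKEvents
import Summits.Ventures.PercRepro2.SideAgreement
import Summits.Ventures.PercRepro2.VdBKahn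
import Summits.Ventures.PercRepro2.BHKAvoid
import Summits.Ventures.PercRepro2.R2PrimeThreeReduction
import Summits.Ventures.PercRepro2.YBridge
import Summits.Ventures.PercRepro2.Yu1Functionals
import Summits.Ventures.PercRepro2.Yu1Events
import Summits.Ventures.PercRepro2.Yu1
import Summits.Ventures.PercRepro2.LBSplit
import Summits.Ventures.PercRepro2.YDelta
import Summits.Ventures.PercRepro2.SD
import Summits.Ventures.PercRepro2.Threshold
import Summits.Ventures.PercRepro2.Lambda
import Summits.Ventures.PercRepro2.LambdaTau
import Summits.Ventures.PercRepro2.LambdaSlack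
import Summits.Ventures.PercRepro2.HF2
import Summits.Ventures.PercRepro2.Yu2
import Summits.Ventures.PercRepro2.N0
import Summits.Ventures.PercRepro2.Y
import Summits.Ventures.PercRepro2.YDeltaTools
import Summits.Ventures.PercRepro2.ZDelta
import Summits.Ventures.PercRepro2.ZExpand
import Summits.Ventures.PercRepro2.ISplit
import Summits.Ventures.PercRepro2.MRl
import Summits.Ventures.PercRepro2.ZOloc
import Summits.Ventures.PercRepro2.SideBridge
import Summits.Ventures.PercRepro2.HCov
import Summits.Ventures.PercRepro2.HCovFns
import Summits.Ventures.PercRepro2.HCovSwap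
import Summits.Ventures.PercRepro2.BasePrime
import Summits.Ventures.PercRepro2.PendantRoot
import Summits.Ventures.PercRepro2.PendantO
import Summits.Ventures.PercRepro2.PendantB
import Summits.Ventures.PercRepro2.PendantBRow
import Summits.Ventures.PercRepro2.LeafStep
import Summits.Ventures.PercRepro2.LeafStepT0
import Summits.Ventures.PercRepro2.LeafChain

/-!
# The leaf row and (HCOV) at the MARKED ends `b` and `o` (blind cell PercRepro2, p1 g7;
`proofs/P1-LEAFSTEP.md` §4, certificates `path2.py`)

At the degenerate marking `a₃ = x` (the end of a pendant path) the leaf row and `Gc` collapse to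
the `a₃`-free masses:
* `x = o`: `Gc(o) = 0` and `R½(o) = P(Z_L + Z_H) = T₀/2 ≥ 0`;
* `x = b`: `Gc(b) = 2[(2bL + D)Y_L + (2bH + D)Y_H] ≥ 0` (`PendantBRow` at `q = 1`) and
  `R½(b) = (2bL + D)Z_L + (2bH + D)Z_H + P(Y_L + Y_H) ≥ 0` (the middle Bernstein coefficient).
With `LeafChain.HCov_pendant_path` this gives (HCOV) at the end of every pendant path of length
two attached at `o` or `b` (`HCov_pendant_path_o`, `HCov_pendant_path_b`), and — iterating
`leafRow_of_leaf` / `HCov_of_leaf` — of any length.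
-/

namespace Summit.Ventures.PercRepro2

open UnionCluster CovForm PendantRoot PendantO

namespace LeafStep

variable {V : Type*} {E : Type*} [Fintype E] [DecidableEq E] [Fintype V] [DecidableEq V]
  {R : Type*} [Field R] [LinearOrder R] [IsStrictOrderedRing R]

variable (p : E → R) (ends : E → Sym2 V)

omit [Fintype V] in
/-- `R½(o) = P(Q)·(Z_L + Z_H)`. -/
lemma Rhalf_o (o a₁ a₂ b : V) :
    Rhalf p ends o a₁ a₂ o b =
      prob p (avoidAll ends a₂ {a₁}) *
        ((prob p (avoidAll ends a₂ {a₁} ∩ connEvent ends a₁ o) *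
            prob p (avoidAll ends a₂ {a₁} ∩ connEvent ends a₂ b) -
          prob p (avoidAll ends a₂ {a₁}) *
            prob p (avoidAll ends a₂ {a₁} ∩ (connEvent ends a₁ o ∩ connEvent ends a₂ b))) +
         (prob p (avoidAll ends a₂ {a₁} ∩ connEvent ends a₂ o) *
            prob p (avoidAll ends a₂ {a₁} ∩ connEvent ends a₁ b) -
          prob p (avoidAll ends a₂ {a₁}) *
            prob p (avoidAll ends a₂ {a₁} ∩ (connEvent ends a₂ o ∩ connEvent ends a₁ b)))) := by
  unfold Rhalf T0 Gc1 mU mUU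
  unfold EQbo EQb3 EQb3o EQo EQ3 EQ3o PDb PDbo Do
  rw [gap_eq_Q]
  simp only [prob_T_v p ends a₁ a₂ o, prob_T'_v p ends a₁ a₂ o, prob_PD_inter_v p ends a₁ a₂ o,
    prob_T_inter_v p ends a₁ a₂ o, prob_T'_inter_v p ends a₁ a₂ o, Q_inter_idem,
    Q_inter_both_eq_empty, Q_inter_both_eq_empty', Q_inter_both_eq_empty₂, Q_inter_both_eq_empty₂',
    prob_empty, Set.inter_self]
  ring

omit [Fintype V] in
/-- `Gc(o) = 0` (the degenerate marking `a₃ = o`). -/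
lemma Gc_o (o a₁ a₂ b : V) : Gc p ends o a₁ a₂ o b = 0 := by
  unfold Gc DEF EQbo EQb3 EQb3o EQo EQ3 EQ3o PDb PDbo Do
  rw [gap_eq_Q]
  simp only [prob_T_v p ends a₁ a₂ o, prob_T'_v p ends a₁ a₂ o, prob_PD_v p ends a₁ a₂ o,
    prob_PD_inter_v p ends a₁ a₂ o, prob_T_inter_v p ends a₁ a₂ o, prob_T'_inter_v p ends a₁ a₂ o,
    Q_inter_idem, Q_inter_both_eq_empty, Q_inter_both_eq_empty', Q_inter_both_eq_empty₂,
    Q_inter_both_eq_empty₂', prob_empty, Set.inter_self]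
  ring

/-- **The leaf row at `o`** holds. -/
theorem leafRow_o (hp : IsProbVec p) (o a₁ a₂ b : V) : LeafRow p ends o a₁ a₂ o b := by
  unfold LeafRow
  rw [Rhalf_o]
  have hZL := PendantB.ZL_nonneg p ends hp o a₁ a₂ b
  have hZH := PendantB.ZH_nonneg p ends hp o a₁ a₂ b
  exact mul_nonneg (prob_nonneg hp _) (add_nonneg (sub_nonneg.2 hZL) (sub_nonneg.2 hZH))

omit [Fintype V] in
/-- **(HCOV) at the degenerate marking `a₃ = o`.** -/
theorem HCov_o (o a₁ a₂ b : V) : HCov p ends o a₁ a₂ o b := by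
  unfold HCov; rw [Gc_o]

/-- **(HCOV) at the end of a pendant path `a₃ – v – o`** (arbitrary weights). -/
theorem HCov_pendant_path_o (hp : IsProbVec p) {f g : E} {a₃ v o : V} (hf : ends f = s(a₃, v))
    (hleaf₃ : ∀ e, a₃ ∈ ends e → e = f) (h3v : a₃ ≠ v) (hg : ends g = s(v, o))
    (hleafv : ∀ e, v ∈ ends e → e = g) (hvo : v ≠ o) {a₁ a₂ b : V} (h31 : a₃ ≠ a₁)
    (h32 : a₃ ≠ a₂) (ho3 : o ≠ a₃) (hb3 : b ≠ a₃) (hv1 : v ≠ a₁) (hv2 : v ≠ a₂) (hbv : b ≠ v) :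
    HCov p ends o a₁ a₂ a₃ b :=
  (HCov_pendant_path p ends hp hf hleaf₃ h3v hg hleafv hvo h31 h32 ho3 hb3 hv1 hv2 (Ne.symm hvo)
    hbv (HCov_o p ends o a₁ a₂ b) (leafRow_o p ends hp o a₁ a₂ b)).1

/-! ## The end `b` -/

omit [Fintype E] [DecidableEq E] [Fintype V] [DecidableEq V] [LinearOrder R] [IsStrictOrderedRing R] in
/-- `Q ∩ (bH ∩ (X ∩ bL)) = ∅`. -/
lemma Q_bH_X_bL (a₁ a₂ b : V) (X : Set (Config E)) :
    avoidAll ends a₂ {a₁} ∩ (connEvent ends a₂ b ∩ (X ∩ connEvent ends a₁ b)) = ∅ := by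
  rw [← Q_inter_both_eq_empty ends a₁ a₂ b X]
  ext ω; simp only [Set.mem_inter_iff]; tauto

omit [Fintype E] [DecidableEq E] [Fintype V] [DecidableEq V] [LinearOrder R] [IsStrictOrderedRing R] in
/-- `Q ∩ (bL ∩ (X ∩ bH)) = ∅`. -/
lemma Q_bL_X_bH (a₁ a₂ b : V) (X : Set (Config E)) :
    avoidAll ends a₂ {a₁} ∩ (connEvent ends a₁ b ∩ (X ∩ connEvent ends a₂ b)) = ∅ := by
  rw [← Q_inter_both_eq_empty ends a₁ a₂ b X]
  ext ω; simp only [Set.mem_inter_iff]; tauto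

omit [Fintype E] [DecidableEq E] [Fintype V] [DecidableEq V] [LinearOrder R] [IsStrictOrderedRing R] in
/-- `Q ∩ (bL ∩ (X ∩ bL)) = Q ∩ (X ∩ bL)`. -/
lemma Q_bL_X_bL (a₁ a₂ b : V) (X : Set (Config E)) :
    avoidAll ends a₂ {a₁} ∩ (connEvent ends a₁ b ∩ (X ∩ connEvent ends a₁ b)) =
      avoidAll ends a₂ {a₁} ∩ (X ∩ connEvent ends a₁ b) := by
  ext ω; simp only [Set.mem_inter_iff]; tauto

omit [Fintype E] [DecidableEq E] [Fintype V] [DecidableEq V] [LinearOrder R] [IsStrictOrderedRing R] in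
/-- `Q ∩ (bH ∩ (X ∩ bH)) = Q ∩ (X ∩ bH)`. -/
lemma Q_bH_X_bH (a₁ a₂ b : V) (X : Set (Config E)) :
    avoidAll ends a₂ {a₁} ∩ (connEvent ends a₂ b ∩ (X ∩ connEvent ends a₂ b)) =
      avoidAll ends a₂ {a₁} ∩ (X ∩ connEvent ends a₂ b) := by
  ext ω; simp only [Set.mem_inter_iff]; tauto

omit [Fintype V] in
/-- `R½(b) = (2bL + D)Z_L + (2bH + D)Z_H + P(Y_L + Y_H)` with `D = P − bL − bH`. -/
lemma Rhalf_b (o a₁ a₂ b : V) :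
    Rhalf p ends o a₁ a₂ b b =
      (2 * (prob p (avoidAll ends a₂ {a₁} ∩ connEvent ends a₁ b)) + ((prob p (avoidAll ends a₂ {a₁})) - (prob p (avoidAll ends a₂ {a₁} ∩ connEvent ends a₁ b)) - (prob p (avoidAll ends a₂ {a₁} ∩ connEvent ends a₂ b)))) * ((prob p (avoidAll ends a₂ {a₁} ∩ connEvent ends a₁ o)) * (prob p (avoidAll ends a₂ {a₁} ∩ connEvent ends a₂ b)) - (prob p (avoidAll ends a₂ {a₁})) * (prob p (avoidAll ends a₂ {a₁} ∩ (connEvent ends a₁ o ∩ connEvent ends a₂ b)))) + (2 * (prob p (avoidAll ends a₂ {a₁} ∩ connEvent ends a₂ b)) + ((prob p (avoidAll ends a₂ {a₁})) - (prob p (avoidAll ends a₂ {a₁} ∩ connEvent ends a₁ b)) - (prob p (avoidAll ends a₂ {a₁} ∩ connEvent ends a₂ b)))) * ((prob p (avoidAll ends a₂ {a₁} ∩ connEvent ends a₂ o)) * (prob p (avoidAll ends a₂ {a₁} ∩ connEvent ends a₁ b)) - (prob p (avoidAll ends a₂ {a₁})) * (prob p (avoidAll ends a₂ {a₁} ∩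 (connEvent ends a₂ o ∩ connEvent ends a₁ b)))) + (prob p (avoidAll ends a₂ {a₁})) * (((prob p (avoidAll ends a₂ {a₁} ∩ connEvent ends a₂ b)) * ((prob p (avoidAll ends a₂ {a₁} ∩ connEvent ends a₁ o)) - (prob p (avoidAll ends a₂ {a₁} ∩ (connEvent ends a₁ o ∩ connEvent ends a₁ b))) - (prob p (avoidAll ends a₂ {a₁} ∩ (connEvent ends a₁ o ∩ connEvent ends a₂ b)))) - ((prob p (avoidAll ends a₂ {a₁})) - (prob p (avoidAll ends a₂ {a₁} ∩ connEvent ends a₁ b)) - (prob p (avoidAll ends a₂ {a₁} ∩ connEvent ends a₂ b))) * (prob p (avoidAll ends a₂ {a₁} ∩ (connEvent ends a₁ o ∩ connEvent ends a₂ b)))) + ((prob p (avoidAll ends a₂ {a₁} ∩ connEvent ends a₁ b)) * ((prob p (avoidAll ends a₂ {a₁} ∩ connEvent ends a₂ o)) - (prob p (avoidAll ends a₂ {a₁} ∩ (connEvent ends a₂ o ∩ connEvent ends a₂ b))) - (prob p (avoidAll ends a₂ {a₁} ∩ (connEvent ends a₂ o ∩ connEvent ends a₁ b)))) - ((prob p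 (avoidAll ends a₂ {a₁})) - (prob p (avoidAll ends a₂ {a₁} ∩ connEvent ends a₁ b)) - (prob p (avoidAll ends a₂ {a₁} ∩ connEvent ends a₂ b))) * (prob p (avoidAll ends a₂ {a₁} ∩ (connEvent ends a₂ o ∩ connEvent ends a₁ b))))) := by
  unfold Rhalf T0 Gc1 mU mUU
  unfold EQbo EQb3 EQb3o EQo EQ3 EQ3o PDb PDbo Do
  rw [gap_eq_Q]
  simp only [prob_T_v p ends a₁ a₂ b, prob_T'_v p ends a₁ a₂ b, prob_PD_inter_v p ends a₁ a₂ b,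
    prob_T_inter_v p ends a₁ a₂ b, prob_T'_inter_v p ends a₁ a₂ b,
    Q_inter_both_eq_empty₂, Q_inter_both_eq_empty₂',
    Q_bH_X_bL, Q_bL_X_bH, Q_bL_X_bL, Q_bH_X_bH, prob_empty, Set.inter_self,
    Set.inter_comm (connEvent ends a₁ b) (connEvent ends a₁ o),
    Set.inter_comm (connEvent ends a₁ b) (connEvent ends a₂ o),
    Set.inter_comm (connEvent ends a₂ b) (connEvent ends a₁ o),
    Set.inter_comm (connEvent ends a₂ b) (connEvent ends a₂ o),
    Set.inter_self]
  ring

omit [Fintype V] in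
/-- `Gc(b) = 2[(2bL + D)Y_L + (2bH + D)Y_H]` (the degenerate marking `a₃ = b`). -/
lemma Gc_b (o a₁ a₂ b : V) :
    Gc p ends o a₁ a₂ b b =
      2 * ((2 * (prob p (avoidAll ends a₂ {a₁} ∩ connEvent ends a₁ b)) + ((prob p (avoidAll ends a₂ {a₁})) - (prob p (avoidAll ends a₂ {a₁} ∩ connEvent ends a₁ b)) - (prob p (avoidAll ends a₂ {a₁} ∩ connEvent ends a₂ b)))) * ((prob p (avoidAll ends a₂ {a₁} ∩ connEvent ends a₂ b)) * ((prob p (avoidAll ends a₂ {a₁} ∩ connEvent ends a₁ o)) - (prob p (avoidAll ends a₂ {a₁} ∩ (connEvent ends a₁ o ∩ connEvent ends a₁ b))) - (prob p (avoidAll ends a₂ {a₁} ∩ (connEvent ends a₁ o ∩ connEvent ends a₂ b)))) - ((prob p (avoidAll ends a₂ {a₁})) - (prob p (avoidAll ends a₂ {a₁} ∩ connEvent ends a₁ b)) - (prob p (avoidAll ends a₂ {a₁} ∩ connEvent ends a₂ b))) * (prob p (avoidAll ends a₂ {a₁} ∩ (connEvent ends a₁ o ∩ connEvent ends a₂ b))))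 + (2 * (prob p (avoidAll ends a₂ {a₁} ∩ connEvent ends a₂ b)) + ((prob p (avoidAll ends a₂ {a₁})) - (prob p (avoidAll ends a₂ {a₁} ∩ connEvent ends a₁ b)) - (prob p (avoidAll ends a₂ {a₁} ∩ connEvent ends a₂ b)))) * ((prob p (avoidAll ends a₂ {a₁} ∩ connEvent ends a₁ b)) * ((prob p (avoidAll ends a₂ {a₁} ∩ connEvent ends a₂ o)) - (prob p (avoidAll ends a₂ {a₁} ∩ (connEvent ends a₂ o ∩ connEvent ends a₂ b))) - (prob p (avoidAll ends a₂ {a₁} ∩ (connEvent ends a₂ o ∩ connEvent ends a₁ b)))) - ((prob p (avoidAll ends a₂ {a₁})) - (prob p (avoidAll ends a₂ {a₁} ∩ connEvent ends a₁ b)) - (prob p (avoidAll ends a₂ {a₁} ∩ connEvent ends a₂ b))) * (prob p (avoidAll ends a₂ {a₁} ∩ (connEvent ends a₂ o ∩ connEvent ends a₁ b))))) := by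
  unfold Gc DEF EQbo EQb3 EQb3o EQo EQ3 EQ3o PDb PDbo Do
  rw [gap_eq_Q]
  simp only [prob_T_v p ends a₁ a₂ b, prob_T'_v p ends a₁ a₂ b, prob_PD_v p ends a₁ a₂ b,
    prob_PD_inter_v p ends a₁ a₂ b, prob_T_inter_v p ends a₁ a₂ b, prob_T'_inter_v p ends a₁ a₂ b,
    Q_inter_both_eq_empty₂,
    Q_inter_both_eq_empty₂', Q_bH_X_bL, Q_bL_X_bH, Q_bL_X_bL, Q_bH_X_bH, prob_empty,
    Set.inter_comm (connEvent ends a₁ b) (connEvent ends a₁ o),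
    Set.inter_comm (connEvent ends a₁ b) (connEvent ends a₂ o),
    Set.inter_comm (connEvent ends a₂ b) (connEvent ends a₁ o),
    Set.inter_comm (connEvent ends a₂ b) (connEvent ends a₂ o),
    Set.inter_self]
  ring

/-- **The leaf row at `b`** holds (the middle Bernstein coefficient of the pendant-at-`b` row). -/
theorem leafRow_b (hp : IsProbVec p) (o a₁ a₂ b : V) : LeafRow p ends o a₁ a₂ b b := by
  unfold LeafRow
  rw [Rhalf_b]
  have hZL := PendantB.ZL_nonneg p ends hp o a₁ a₂ b
  have hZH := PendantB.ZH_nonneg p ends hp o a₁ a₂ b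
  have hYL := PendantB.YL_nonneg p ends hp o a₁ a₂ b
  have hYH := PendantB.YH_nonneg p ends hp o a₁ a₂ b
  have hsum := PendantB.bL_add_bH_le p ends hp a₁ a₂ b
  have hP := prob_nonneg hp (avoidAll ends a₂ {a₁})
  have hbL := prob_nonneg hp (avoidAll ends a₂ {a₁} ∩ connEvent ends a₁ b)
  have hbH := prob_nonneg hp (avoidAll ends a₂ {a₁} ∩ connEvent ends a₂ b)
  have hmL : 0 ≤ 2 * (prob p (avoidAll ends a₂ {a₁} ∩ connEvent ends a₁ b)) + ((prob p (avoidAll ends a₂ {a₁})) - (prob p (avoidAll ends a₂ {a₁} ∩ connEvent ends a₁ b)) - (prob p (avoidAll ends a₂ {a₁} ∩ connEvent ends a₂ b))) := by linarith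
  have hmH : 0 ≤ 2 * (prob p (avoidAll ends a₂ {a₁} ∩ connEvent ends a₂ b)) + ((prob p (avoidAll ends a₂ {a₁})) - (prob p (avoidAll ends a₂ {a₁} ∩ connEvent ends a₁ b)) - (prob p (avoidAll ends a₂ {a₁} ∩ connEvent ends a₂ b))) := by linarith
  have hZL' : 0 ≤ (prob p (avoidAll ends a₂ {a₁} ∩ connEvent ends a₁ o)) * (prob p (avoidAll ends a₂ {a₁} ∩ connEvent ends a₂ b)) - (prob p (avoidAll ends a₂ {a₁})) * (prob p (avoidAll ends a₂ {a₁} ∩ (connEvent ends a₁ o ∩ connEvent ends a₂ b))) := by linarith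
  have hZH' : 0 ≤ (prob p (avoidAll ends a₂ {a₁} ∩ connEvent ends a₂ o)) * (prob p (avoidAll ends a₂ {a₁} ∩ connEvent ends a₁ b)) - (prob p (avoidAll ends a₂ {a₁})) * (prob p (avoidAll ends a₂ {a₁} ∩ (connEvent ends a₂ o ∩ connEvent ends a₁ b))) := by linarith
  have hYL' : 0 ≤ (prob p (avoidAll ends a₂ {a₁} ∩ connEvent ends a₂ b)) * ((prob p (avoidAll ends a₂ {a₁} ∩ connEvent ends a₁ o)) - (prob p (avoidAll ends a₂ {a₁} ∩ (connEvent ends a₁ o ∩ connEvent ends a₁ b))) - (prob p (avoidAll ends a₂ {a₁} ∩ (connEvent ends a₁ o ∩ connEvent ends a₂ b)))) - ((prob p (avoidAll ends a₂ {a₁})) - (prob p (avoidAll ends a₂ {a₁} ∩ connEvent ends a₁ b)) - (prob p (avoidAll ends a₂ {a₁} ∩ connEvent ends a₂ b))) * (prob p (avoidAll ends a₂ {a₁} ∩ (connEvent ends a₁ o ∩ connEvent ends a₂ b))) := by linarith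
  have hYH' : 0 ≤ (prob p (avoidAll ends a₂ {a₁} ∩ connEvent ends a₁ b)) * ((prob p (avoidAll ends a₂ {a₁} ∩ connEvent ends a₂ o)) - (prob p (avoidAll ends a₂ {a₁} ∩ (connEvent ends a₂ o ∩ connEvent ends a₂ b))) - (prob p (avoidAll ends a₂ {a₁} ∩ (connEvent ends a₂ o ∩ connEvent ends a₁ b)))) - ((prob p (avoidAll ends a₂ {a₁})) - (prob p (avoidAll ends a₂ {a₁} ∩ connEvent ends a₁ b)) - (prob p (avoidAll ends a₂ {a₁} ∩ connEvent ends a₂ b))) * (prob p (avoidAll ends a₂ {a₁} ∩ (connEvent ends a₂ o ∩ connEvent ends a₁ b))) := by linarith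
  exact add_nonneg (add_nonneg (mul_nonneg hmL hZL') (mul_nonneg hmH hZH'))
    (mul_nonneg hP (add_nonneg hYL' hYH'))

/-- **(HCOV) at the degenerate marking `a₃ = b`.** -/
theorem HCov_b (hp : IsProbVec p) (o a₁ a₂ b : V) : HCov p ends o a₁ a₂ b b := by
  unfold HCov
  rw [Gc_b]
  have hYL := PendantB.YL_nonneg p ends hp o a₁ a₂ b
  have hYH := PendantB.YH_nonneg p ends hp o a₁ a₂ b
  have hsum := PendantB.bL_add_bH_le p ends hp a₁ a₂ b
  have hbL := prob_nonneg hp (avoidAll ends a₂ {a₁} ∩ connEvent ends a₁ b)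
  have hbH := prob_nonneg hp (avoidAll ends a₂ {a₁} ∩ connEvent ends a₂ b)
  have hmL : 0 ≤ 2 * (prob p (avoidAll ends a₂ {a₁} ∩ connEvent ends a₁ b)) + ((prob p (avoidAll ends a₂ {a₁})) - (prob p (avoidAll ends a₂ {a₁} ∩ connEvent ends a₁ b)) - (prob p (avoidAll ends a₂ {a₁} ∩ connEvent ends a₂ b))) := by linarith
  have hmH : 0 ≤ 2 * (prob p (avoidAll ends a₂ {a₁} ∩ connEvent ends a₂ b)) + ((prob p (avoidAll ends a₂ {a₁})) - (prob p (avoidAll ends a₂ {a₁} ∩ connEvent ends a₁ b)) - (prob p (avoidAll ends a₂ {a₁} ∩ connEvent ends a₂ b))) := by linarith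
  have hYL' : 0 ≤ (prob p (avoidAll ends a₂ {a₁} ∩ connEvent ends a₂ b)) * ((prob p (avoidAll ends a₂ {a₁} ∩ connEvent ends a₁ o)) - (prob p (avoidAll ends a₂ {a₁} ∩ (connEvent ends a₁ o ∩ connEvent ends a₁ b))) - (prob p (avoidAll ends a₂ {a₁} ∩ (connEvent ends a₁ o ∩ connEvent ends a₂ b)))) - ((prob p (avoidAll ends a₂ {a₁})) - (prob p (avoidAll ends a₂ {a₁} ∩ connEvent ends a₁ b)) - (prob p (avoidAll ends a₂ {a₁} ∩ connEvent ends a₂ b))) * (prob p (avoidAll ends a₂ {a₁} ∩ (connEvent ends a₁ o ∩ connEvent ends a₂ b))) := by linarith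
  have hYH' : 0 ≤ (prob p (avoidAll ends a₂ {a₁} ∩ connEvent ends a₁ b)) * ((prob p (avoidAll ends a₂ {a₁} ∩ connEvent ends a₂ o)) - (prob p (avoidAll ends a₂ {a₁} ∩ (connEvent ends a₂ o ∩ connEvent ends a₂ b))) - (prob p (avoidAll ends a₂ {a₁} ∩ (connEvent ends a₂ o ∩ connEvent ends a₁ b)))) - ((prob p (avoidAll ends a₂ {a₁})) - (prob p (avoidAll ends a₂ {a₁} ∩ connEvent ends a₁ b)) - (prob p (avoidAll ends a₂ {a₁} ∩ connEvent ends a₂ b))) * (prob p (avoidAll ends a₂ {a₁} ∩ (connEvent ends a₂ o ∩ connEvent ends a₁ b))) := by linarith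
  exact mul_nonneg (by norm_num) (add_nonneg (mul_nonneg hmL hYL') (mul_nonneg hmH hYH'))

/-- **(HCOV) at the end of a pendant path `a₃ – v – b`** (arbitrary weights). -/
theorem HCov_pendant_path_b (hp : IsProbVec p) {f g : E} {a₃ v b : V} (hf : ends f = s(a₃, v))
    (hleaf₃ : ∀ e, a₃ ∈ ends e → e = f) (h3v : a₃ ≠ v) (hg : ends g = s(v, b))
    (hleafv : ∀ e, v ∈ ends e → e = g) (hvb : v ≠ b) {o a₁ a₂ : V} (h31 : a₃ ≠ a₁)
    (h32 : a₃ ≠ a₂) (ho3 : o ≠ a₃) (hb3 : b ≠ a₃) (hv1 : v ≠ a₁) (hv2 : v ≠ a₂) (hov : o ≠ v) :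
    HCov p ends o a₁ a₂ a₃ b :=
  (HCov_pendant_path p ends hp hf hleaf₃ h3v hg hleafv hvb h31 h32 ho3 hb3 hv1 hv2 hov
    (Ne.symm hvb) (HCov_b p ends hp o a₁ a₂ b) (leafRow_b p ends hp o a₁ a₂ b)).1


/-! ## The end `a₂` (a root) -/

omit [Fintype E] [DecidableEq E] [Fintype V] [DecidableEq V] [LinearOrder R] [IsStrictOrderedRing R] in
/-- A vertex is connected to itself. -/
lemma connEvent_self (x : V) : connEvent ends x x = Set.univ := by
  ext ω; simp [connEvent, conn_refl]

omit [Fintype E] [DecidableEq E] [Fintype V] [DecidableEq V] [LinearOrder R] [IsStrictOrderedRing R] in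
/-- Under `Q` the roots are not connected: `Q ∩ ({a₁ ↔ a₂} ∩ X) = ∅`. -/
lemma Q_inter_conn_roots (a₁ a₂ : V) (X : Set (Config E)) :
    avoidAll ends a₂ {a₁} ∩ (connEvent ends a₁ a₂ ∩ X) = ∅ := by
  ext ω
  simp only [Set.mem_inter_iff, avoidAll, Set.mem_setOf_eq, Finset.mem_singleton, forall_eq,
    connEvent, Set.mem_empty_iff_false, iff_false, not_and]
  intro hQ h _
  exact hQ (conn_symm h)

omit [Fintype E] [DecidableEq E] [Fintype V] [DecidableEq V] [LinearOrder R] [IsStrictOrderedRing R] in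
/-- Under `Q` the roots are not connected (two factors). -/
lemma Q_inter_conn_roots₂ (a₁ a₂ : V) : avoidAll ends a₂ {a₁} ∩ connEvent ends a₁ a₂ = ∅ := by
  have := Q_inter_conn_roots ends a₁ a₂ Set.univ
  rwa [Set.inter_univ] at this

omit [Fintype V] in
/-- `R½(a₂) = P(Q)·(Z_L + W_L)` with `W_L = P·A − oL·bL` the BHK 1.3 slack. -/
lemma Rhalf_root (o a₁ a₂ b : V) :
    Rhalf p ends o a₁ a₂ a₂ b =
      prob p (avoidAll ends a₂ {a₁}) *
        ((prob p (avoidAll ends a₂ {a₁} ∩ connEvent ends a₁ o) *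
            prob p (avoidAll ends a₂ {a₁} ∩ connEvent ends a₂ b) -
          prob p (avoidAll ends a₂ {a₁}) *
            prob p (avoidAll ends a₂ {a₁} ∩ (connEvent ends a₁ o ∩ connEvent ends a₂ b))) +
         (prob p (avoidAll ends a₂ {a₁}) *
            prob p (avoidAll ends a₂ {a₁} ∩ (connEvent ends a₁ o ∩ connEvent ends a₁ b)) -
          prob p (avoidAll ends a₂ {a₁} ∩ connEvent ends a₁ o) *
            prob p (avoidAll ends a₂ {a₁} ∩ connEvent ends a₁ b))) := by
  unfold Rhalf T0 Gc1 mU mUU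
  unfold EQbo EQb3 EQb3o EQo EQ3 EQ3o PDb PDbo Do
  rw [gap_eq_Q]
  simp only [prob_T_v p ends a₁ a₂ a₂, prob_T'_v p ends a₁ a₂ a₂, prob_PD_inter_v p ends a₁ a₂ a₂,
    prob_T_inter_v p ends a₁ a₂ a₂, prob_T'_inter_v p ends a₁ a₂ a₂, connEvent_self, Set.univ_inter,
    Set.inter_univ, Q_inter_conn_roots, Q_inter_conn_roots₂, prob_empty]
  ring

omit [Fintype V] in
/-- `Gc(a₂) = 0` (the degenerate marking `a₃ = a₂`). -/
lemma Gc_root (o a₁ a₂ b : V) : Gc p ends o a₁ a₂ a₂ b = 0 := by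
  unfold Gc DEF EQbo EQb3 EQb3o EQo EQ3 EQ3o PDb PDbo Do
  rw [gap_eq_Q]
  simp only [prob_T_v p ends a₁ a₂ a₂, prob_T'_v p ends a₁ a₂ a₂, prob_PD_v p ends a₁ a₂ a₂,
    prob_PD_inter_v p ends a₁ a₂ a₂, prob_T_inter_v p ends a₁ a₂ a₂, prob_T'_inter_v p ends a₁ a₂ a₂,
    connEvent_self, Set.univ_inter, Set.inter_univ, Q_inter_conn_roots, Q_inter_conn_roots₂,
    prob_empty]
  ring

/-- **The leaf row at the root `a₂`** holds (a BHK 1.4 slack plus a BHK 1.3 slack). -/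
theorem leafRow_root (hp : IsProbVec p) (o a₁ a₂ b : V) : LeafRow p ends o a₁ a₂ a₂ b := by
  unfold LeafRow
  rw [Rhalf_root]
  have hZL := PendantB.ZL_nonneg p ends hp o a₁ a₂ b
  have hW := covC_same_nonneg p ends hp o a₁ a₂ b
  unfold covC at hW
  exact mul_nonneg (prob_nonneg hp _) (add_nonneg (sub_nonneg.2 hZL) hW)

omit [Fintype V] in
/-- **(HCOV) at the degenerate marking `a₃ = a₂`.** -/
theorem HCov_root (o a₁ a₂ b : V) : HCov p ends o a₁ a₂ a₂ b := by
  unfold HCov; rw [Gc_root]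

/-- **(HCOV) at the end of a pendant path `a₃ – v – a₂`** (arbitrary weights). -/
theorem HCov_pendant_path_root (hp : IsProbVec p) {f g : E} {a₃ v a₂ : V} (hf : ends f = s(a₃, v))
    (hleaf₃ : ∀ e, a₃ ∈ ends e → e = f) (h3v : a₃ ≠ v) (hg : ends g = s(v, a₂))
    (hleafv : ∀ e, v ∈ ends e → e = g) (hv2 : v ≠ a₂) {o a₁ b : V} (h31 : a₃ ≠ a₁)
    (h32 : a₃ ≠ a₂) (ho3 : o ≠ a₃) (hb3 : b ≠ a₃) (hv1 : v ≠ a₁) (hov : o ≠ v) (hbv : b ≠ v) :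
    HCov p ends o a₁ a₂ a₃ b :=
  (HCov_pendant_path p ends hp hf hleaf₃ h3v hg hleafv hv2 h31 h32 ho3 hb3 hv1 hv2 hov hbv
    (HCov_root p ends o a₁ a₂ b) (leafRow_root p ends hp o a₁ a₂ b)).1


end LeafStep

end Summit.Ventures.PercRepro2
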